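import Summits.Parity.GeneralizedHardyLittlewood.Theorems.GreenTaoLevelTwoMNTwoTypeIIFirstCS
import Summits.Parity.GeneralizedHardyLittlewood.Theorems.GreenTaoLevelTwoMNTwoTypeIISecondCS

/-!
# Route `GreenTaoLevelTwo`, crux `MNTwo` (stmt-Parity-21276), line `birth`, stub `stub_mnVertical`:
# from a large weighted progression sum to the sixteenfold sum (GT 2008b §10, proof of Lemma 24)

Third step of the remaining Lemma-24 assembly for `stub_mnVertical` (B. Green, T. Tao, *Quadratic
uniformity of the Möbius function*, Ann. Inst. Fourier 58 (2008) = arXiv:math/0606087, §10: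
"Applying the Cauchy-Schwarz inequality (csi) twice … we obtain …").  Def-free composition of
`…MNTwoTypeIIFirstCS.first_cs_differences` and `…MNTwoTypeIISecondCS.second_cs_pigeonhole`:
if `f : ℤ → ℤ → ℂ` vanishes outside `[1,L] × [1,M]`, `b, b'` are `1`-bounded and
`Z ≤ ‖∑_{l,m} b(l)b'(m)f(l,m)‖` (`Z ≥ 0`), then some `(l₀, m₀) ∈ [1,L] × [1,M]` has
`(Z⁴/(L²M²))⁴ / ((2L+1)³(2M+1)³L³M³) ≤ Re Σ₁₆(f; l₀, m₀)` (the sixteenfold alternating sum of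
`second_cs_pigeonhole`).

* `typeII_sixteenfold` — the statement just described.

References: [GreenTao2008QuadraticMobius] arXiv:math/0606087 §10 (proof of Lemma 24).
-/

noncomputable section

open Finset
open scoped ComplexConjugate

namespace Summit.Parity.GeneralizedHardyLittlewood.GreenTaoLevelTwoMNTwoTypeIISixteenfold

open Summit.Parity.GeneralizedHardyLittlewood.GreenTaoLevelTwoMNTwoTypeIIFirstCS
  (first_cs_differences)
open Summit.Parity.GeneralizedHardyLittlewood.GreenTaoLevelTwoMNTwoTypeIISecondCS
  (second_cs_pigeonhole)

/-- **Two Cauchy–Schwarz steps and a pigeonhole (GT 2008b §10).**  For `f` vanishing outside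
`[1,L] × [1,M]` (`L, M ≥ 1`), `1`-bounded `b, b'` and `0 ≤ Z ≤ ‖∑_{l∈[1,L]} ∑_{m∈[1,M]} b(l)b'(m)f(l,m)‖`,
some `l₀ ∈ [1,L]`, `m₀ ∈ [1,M]` has
`(Z⁴/(L²M²))⁴/((2L+1)³(2M+1)³L³M³) ≤ Re Σ₁₆(f; l₀, m₀)`.
[cite: GreenTao2008QuadraticMobius, §10 (proof of Lemma 24, (csi) twice)] -/
theorem typeII_sixteenfold {L M : ℕ} (hL : 1 ≤ L) (hM : 1 ≤ M) (f : ℤ → ℤ → ℂ)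
    (hf : ∀ l m, (l ∉ Icc (1 : ℤ) L ∨ m ∉ Icc (1 : ℤ) M) → f l m = 0)
    (b b' : ℤ → ℂ) (hb : ∀ l, ‖b l‖ ≤ 1) (hb' : ∀ m, ‖b' m‖ ≤ 1) {Z : ℝ} (hZ : 0 ≤ Z)
    (hlarge : Z ≤ ‖∑ l ∈ Icc (1 : ℤ) L, ∑ m ∈ Icc (1 : ℤ) M, b l * b' m * f l m‖) :
    ∃ l₀ ∈ Icc (1 : ℤ) L, ∃ m₀ ∈ Icc (1 : ℤ) M,
      (Z ^ 4 / ((L : ℝ) ^ 2 * (M : ℝ) ^ 2)) ^ 4 /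
          (((2 * L + 1 : ℕ) : ℝ) ^ 3 * ((2 * M + 1 : ℕ) : ℝ) ^ 3 * (L : ℝ) ^ 3 * (M : ℝ) ^ 3) ≤
      (∑ l₁ ∈ Icc (-(L : ℤ)) L, ∑ m₁ ∈ Icc (-(M : ℤ)) M, ∑ l₂ ∈ Icc (-(L : ℤ)) L,
        ∑ m₂ ∈ Icc (-(M : ℤ)) M,
        (f l₀ m₀ * conj (f l₀ (m₀ + m₁)) * conj (f (l₀ + l₁) m₀) * f (l₀ + l₁) (m₀ + m₁)) *
        conj (f l₀ (m₀ + m₂) * conj (f l₀ (m₀ + m₂ + m₁)) * conj (f (l₀ + l₁) (m₀ + m₂)) *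
          f (l₀ + l₁) (m₀ + m₂ + m₁)) *
        conj (f (l₀ + l₂) m₀ * conj (f (l₀ + l₂) (m₀ + m₁)) * conj (f (l₀ + l₂ + l₁) m₀) *
          f (l₀ + l₂ + l₁) (m₀ + m₁)) *
        (f (l₀ + l₂) (m₀ + m₂) * conj (f (l₀ + l₂) (m₀ + m₂ + m₁)) *
          conj (f (l₀ + l₂ + l₁) (m₀ + m₂)) * f (l₀ + l₂ + l₁) (m₀ + m₂ + m₁))).re := by
  have hLr : (0 : ℝ) < L := by exact_mod_cast hL
  have hMr : (0 : ℝ) < M := by exact_mod_cast hM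
  have h1 := first_cs_differences (L := L) (M := M) f hf b b' hb hb'
  -- `Z⁴ ≤ ‖Σ‖⁴ ≤ L²M² Re Σ₄ ≤ L²M² Σ ‖·‖`
  have hZ4 : Z ^ 4 ≤ ‖∑ l ∈ Icc (1 : ℤ) L, ∑ m ∈ Icc (1 : ℤ) M, b l * b' m * f l m‖ ^ 4 :=
    pow_le_pow_left₀ hZ hlarge 4
  have hre : (∑ l₁ ∈ Icc (-(L : ℤ)) L, ∑ m₁ ∈ Icc (-(M : ℤ)) M, ∑ l ∈ Icc (1 : ℤ) L,
      ∑ m ∈ Icc (1 : ℤ) M,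
        f l m * conj (f l (m + m₁)) * conj (f (l + l₁) m) * f (l + l₁) (m + m₁)).re ≤
      ∑ l₁ ∈ Icc (-(L : ℤ)) L, ∑ m₁ ∈ Icc (-(M : ℤ)) M,
        ‖∑ l ∈ Icc (1 : ℤ) L, ∑ m ∈ Icc (1 : ℤ) M,
          f l m * conj (f l (m + m₁)) * conj (f (l + l₁) m) * f (l + l₁) (m + m₁)‖ := by
    rw [Complex.re_sum]
    refine Finset.sum_le_sum fun l₁ _ => ?_
    rw [Complex.re_sum]
    refine Finset.sum_le_sum fun m₁ _ => ?_
    exact (Complex.re_le_norm _)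
  have hY : Z ^ 4 / ((L : ℝ) ^ 2 * (M : ℝ) ^ 2) ≤
      ∑ l₁ ∈ Icc (-(L : ℤ)) L, ∑ m₁ ∈ Icc (-(M : ℤ)) M,
        ‖∑ l ∈ Icc (1 : ℤ) L, ∑ m ∈ Icc (1 : ℤ) M,
          f l m * conj (f l (m + m₁)) * conj (f (l + l₁) m) * f (l + l₁) (m + m₁)‖ := by
    rw [div_le_iff₀ (by positivity)]
    calc Z ^ 4 ≤ _ := hZ4
      _ ≤ _ := h1
      _ ≤ (L : ℝ) ^ 2 * (M : ℝ) ^ 2 * ∑ l₁ ∈ Icc (-(L : ℤ)) L, ∑ m₁ ∈ Icc (-(M : ℤ)) M,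
            ‖∑ l ∈ Icc (1 : ℤ) L, ∑ m ∈ Icc (1 : ℤ) M,
              f l m * conj (f l (m + m₁)) * conj (f (l + l₁) m) * f (l + l₁) (m + m₁)‖ :=
          mul_le_mul_of_nonneg_left hre (by positivity)
      _ = _ := by ring
  exact second_cs_pigeonhole hL hM f hf (by positivity) hY

end Summit.Parity.GeneralizedHardyLittlewood.GreenTaoLevelTwoMNTwoTypeIISixteenfold
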